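/-
Copyright (c) 2026. All rights reserved.
Released under Apache 2.0 license as described in the file LICENSE.
-/
import Literature.Probability.FitznerVanDerHofstad2017.NobleBoundsNTargets
import Literature.Probability.FitznerVanDerHofstad2017.NobleBoundsNMidS
import Literature.Probability.FitznerVanDerHofstad2017.NobleBoundsNMidSZero
import Literature.Probability.FitznerVanDerHofstad2017.NobleBoundsNMidSOne
import Literature.Probability.FitznerVanDerHofstad2017.NobleBoundsNMidSZeroExit
import Literature.Probability.FitznerVanDerHofstad2017.NobleBoundsNMidSOpen
import Literature.Probability.FitznerVanDerHofstad2017.NobleBoundsNMidF1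
import Literature.Probability.FitznerVanDerHofstad2017.NobleBoundsNMidECut
import Literature.Probability.FitznerVanDerHofstad2017.NobleBoundsNMidEProper
import Literature.Probability.FitznerVanDerHofstad2017.NobleBoundsNMidEProperTZ
import Literature.Probability.FitznerVanDerHofstad2017.NobleBoundsNFirstS
import Literature.Probability.FitznerVanDerHofstad2017.NobleBoundsNFirstSNe
import Literature.Probability.FitznerVanDerHofstad2017.NobleBoundsNFirstSLow
import Literature.Probability.FitznerVanDerHofstad2017.NobleBoundsNFirstSOpen
import Literature.Probability.FitznerVanDerHofstad2017.NobleBoundsNFirstF1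
import Literature.Probability.FitznerVanDerHofstad2017.NobleBoundsNFirstECut
import Literature.Probability.FitznerVanDerHofstad2017.NobleBoundsNFirstEProper
import Literature.Probability.FitznerVanDerHofstad2017.NobleBoundsNFirstEProperTZ
import HarnessLib

/-!
# Fitzner–van der Hofstad (2017), §6.1 (6.4) / §5.1 (5.4) / App. B: the `pkg` DISPATCH of the `N ≥ 2` chain at the junctions with REGULAR class pairs

[FvdH17] = R. Fitzner, R. van der Hofstad, *Mean-field behavior for nearest-neighbor percolation in `d > 10`*,
arXiv:1506.07977v2 (EJP 22 (2017), paper 43).  Page numbers refer to the arXiv version.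

The class estimate `NobleBoundsNGrouped.prod_bondJ_mul_piPerc_jwCover_le_chain_of_packages` ((6.4), the sum
over the "cases `a`, `b`" of §6.1, pp. 58–59) wants, for every direction vector `κ`, every admissible variant `τ`
and every junction `k`, ONE package `Nonempty (JPkg p (jctx … k) (JFacts …) (jTarget M (tgt κ) (tgtL κ) τ k))`
(hypothesis `pkg`).  The last junction is dispatched by `NobleBoundsNEndC1.nonempty_jPkg_end_starA`.  This file
dispatches the FIRST and the MIDDLE junctions whose two class labels are regular (`a k = inl a₀`,
`a (k+1) = inl a′`) onto the cell theorems of the b2b-lace packet, against the regular target family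
`NobleBoundsNTargets.tgtReg` (whose sum over the variants is at most the pointwise primed middle block (5.4),
`sum_tgtReg_le_blockBFullpt'`, `sum_filter_blockPS_mul_tgtReg_le`):

* variant `F‴` (`(τ i).1 = false`, inner class `c`): target `A'^{κ,a₀,c,*}(u,w,t,z)·A^{c,a′}(t,z,w′,u′)` —
  `a′ = 0`: `NobleBoundsNMidS` (`c = 2`), `NobleBoundsNMidSZero` / `NobleBoundsNMidSZeroExit` (`c = 0`),
  `NobleBoundsNMidSOne` / `NobleBoundsNMidSZeroExit` (`c = 1`); `a′ ≠ 0` off the corner `w′ ≠ t`: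
  `NobleBoundsNMidSOpen`; `a′ ≠ 0` on the corner `w′ = t`: HYPOTHESIS SLOT `hR'` (cell `R′` of DIVERGENCE D77);
* variant `F′` (`(τ i).1 = true`, `t = u′`): `NobleBoundsNMidF1.nonempty_jPkg_midF1_term₂'` (inner class `0`),
  vacuous at inner class `≠ 0` (`z = t` is forced);
* variant `F″` (`(τ i).1 = true`, `t ≠ u′`): exit class `a′ ≤ 1` vacuous (clause (8)); cut-through (inner class
  `0`, `z = t`): `NobleBoundsNMidECut.nonempty_jPkg_midE_cut_term₂'` off `Adj w′ t`, HYPOTHESIS SLOT `hR` on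
  `Adj w′ t` (cell `R` of D77); proper, inner class `1`: `NobleBoundsNMidEProperTZ` (rows `a₀ = 0, 1, 2`); proper,
  inner class `2`: `NobleBoundsNMidEProper` (rows `a₀ = 0, 2`), HYPOTHESIS SLOT `hK2` for the row `(1, ≥2 | d ≥ 2)`;

and the same table at the first junction behind the start letter `P^{S,a₀}(u_0,w_0)` (`NobleBoundsNFirstS`,
`…FirstSNe`, `…FirstSLow`, `…FirstSOpen`, `…FirstF1`, `…FirstECut`, `…FirstEProper`, `…FirstEProperTZ`).
Each slot concludes the same `tgtReg` target as the theorem, so a later cell theorem discharges it by name.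
The junctions with a `★` label are NOT treated here.

Conventions: `d`-generic; nothing is cited as a fact; additive (no existing declaration is changed); the three
slots assert nothing — they are hypotheses.
-/

noncomputable section

namespace Literature.Probability.FitznerVanDerHofstad2017

open Literature.Barriers.CriticalPhenomena Literature.Probability.Percolation
open Literature.Probability.LatticeModels Literature.Combinatorics.SimpleGraph _root_.SimpleGraph
open _root_.MeasureTheory
open Literature.Probability.FitznerVanDerHofstad2017.NobleBlocks
open Literature.Probability.FitznerVanDerHofstad2017.NobleBlocks.LenIdx
open scoped ENNReal

variable {d : ℕ}

section Packages

variable (p : unitInterval) (M : ℕ) (x : Site d) (b : Fin (M + 2) → Site d × Site d) (w t z : Fin (M + 2) → Site d)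
  (a : Fin (M + 2) → Fin 3 ⊕ Unit) (c : Fin 3 ⊕ Unit) (τ : Fin (M + 1) → Bool × Fin 3)

local notation "𝐋" => Letters.perc d p

/-! ### A. The middle junctions `k = i₀ + 1`, `1 ≤ k ≤ M` -/

/-- **`pkg` at a MIDDLE junction with regular class pair `(a₀, a′)`**: for every variant `τ i` a package with
target `tgtReg 𝐋 κ a₀ a′ (u_k, w_k, t_k, z_k, w_{k+1}, u_{k+1}) (τ i)`, routed by the kind bit, the inner class,
the exit class `a′` and the parameter regimes to the cell theorems of the packet ([FvdH17] §6.1 "Case `a = 0,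
1, ≥ 2`" × "Case `b = 0, 1, ≥ 2`", pp. 58–59, with the `F′`/`F″` rows of App. B Table `B^{(2),ι,a,b}`, p. 76);
the three cells not in the tree — `F‴` on the corner `w_{k+1} = t_k` with `a′ ≠ 0` (`hR'`), the `F″`
cut-through with `w_{k+1} ∼ t_k` (`hR`), the `F″`-proper row `(1, ≥2 | d ≥ 2)` (`hK2`) — are hypotheses with
the same target.
[cite: FitznerVanDerHofstad2017, §6.1 (6.4) "Case a = 0 / a = 1 / a ≥ 2", "Case b = 0 / b = 1 / b ≥ 2" (arXiv:1506.07977v2 pp. 58–59); §5.1 (5.4) (p. 48); App. B Table "B^{(2),ι,a,b}" (p. 76)] -/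
theorem nonempty_jPkg_mid_reg (i i₀ : Fin (M + 1)) (hk : i₀.succ = i.castSucc) (κ : Fin d × Bool)
    (hb : (b i.castSucc).2 = (b i.castSucc).1 + stepVec κ) (a₀ a' : Fin 3)
    (ha : a i.castSucc = Sum.inl a₀) (ha' : a i.succ = Sum.inl a')
    (hR' : (τ i).1 = false → a' ≠ 0 → w i.succ = t i.castSucc →
      Nonempty (JPkg p (jctx M x b w t z a τ i.castSucc) (JFacts M x b w t z a c τ)
        (tgtReg 𝐋 κ a₀ a' (b i.castSucc).1 (w i.castSucc) (t i.castSucc) (z i.castSucc) (w i.succ) (b i.succ).1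
          (τ i))))
    (hR : τ i = (true, 0) → a' = 2 → t i.castSucc ≠ (b i.succ).1 → z i.castSucc = t i.castSucc →
      (zdGraph d).Adj (w i.succ) (t i.castSucc) →
      Nonempty (JPkg p (jctx M x b w t z a τ i.castSucc) (JFacts M x b w t z a c τ)
        (tgtReg 𝐋 κ a₀ a' (b i.castSucc).1 (w i.castSucc) (t i.castSucc) (z i.castSucc) (w i.succ) (b i.succ).1
          (τ i))))
    (hK2 : τ i = (true, 2) → a₀ = 1 → a' = 2 → t i.castSucc ≠ (b i.succ).1 →
      Nonempty (JPkg p (jctx M x b w t z a τ i.castSucc) (JFacts M x b w t z a c τ)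
        (tgtReg 𝐋 κ a₀ a' (b i.castSucc).1 (w i.castSucc) (t i.castSucc) (z i.castSucc) (w i.succ) (b i.succ).1
          (τ i)))) :
    Nonempty (JPkg p (jctx M x b w t z a τ i.castSucc) (JFacts M x b w t z a c τ)
      (tgtReg 𝐋 κ a₀ a' (b i.castSucc).1 (w i.castSucc) (t i.castSucc) (z i.castSucc) (w i.succ) (b i.succ).1
        (τ i))) := by
  have h3 : ∀ e : Fin 3, e = 0 ∨ e = 1 ∨ e = 2 := by decide
  rcases Bool.eq_false_or_eq_true (τ i).1 with hσ | hσ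
  · -- kind bit `true`: the level `k + 1` is of kind `midE` (`F′` if `t_k = u_{k+1}`, `F″` otherwise)
    by_cases hty : t i.castSucc = (b i.succ).1
    · -- `F′`
      rcases h3 (τ i).2 with hc | hc | hc
      · have hv : τ i = (true, 0) := Prod.ext hσ hc
        rw [hv, tgtReg_true_zero]
        exact nonempty_jPkg_midF1_term₂' p M x b w t z a c τ i i₀ hk κ hb hσ a₀ a' ha ha' hty
      all_goals
        by_cases hzt : z i.castSucc = t i.castSucc
        · exact nonempty_jPkg_of_innerClass_ne_zero_eq p c _ i (by rw [hc]; decide) hzt.symm _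
        · exact nonempty_jPkg_of_midE_t_eq_z_ne p M x b w t z a c τ _ i hσ ha' hty hzt _
    · -- `F″`
      by_cases ha'2 : a' = 2
      swap
      · exact nonempty_jPkg_of_sharp p c _ i hσ ha' ha'2 hty _
      subst ha'2
      rcases h3 (τ i).2 with hc | hc | hc
      · -- cut-through: inner class `0`
        by_cases hzt : z i.castSucc = t i.castSucc
        swap
        · exact nonempty_jPkg_of_innerClass_zero_ne p c _ i hc (Ne.symm hzt) _
        by_cases hadj : (zdGraph d).Adj (w i.succ) (t i.castSucc)
        · exact hR (Prod.ext hσ hc) rfl hty hzt hadj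
        · have hv : τ i = (true, 0) := Prod.ext hσ hc
          rw [hv, tgtReg_true_zero]
          exact nonempty_jPkg_midE_cut_term₂' p M x b w t z a c τ i i₀ hk κ hb hσ a₀ ha ha' hty hzt hadj
      · -- proper, inner class `1` (rows `d = 1`)
        have hv : τ i = (true, 1) := Prod.ext hσ hc
        rcases h3 a₀ with h0 | h0 | h0 <;> subst h0
        · rw [hv, tgtReg_true_one_zero_two]
          exact nonempty_jPkg_midE_properTZ_zero_two_lit p M x b w t z a c τ i i₀ hk κ hb hσ hc ha ha' hty
        · rw [hv, tgtReg_true_one_one_two]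
          exact nonempty_jPkg_midE_properTZ_one_two_lit p M x b w t z a c τ i i₀ hk κ hb hσ hc ha ha' hty
        · rw [hv, tgtReg_true_one_two_two]
          exact nonempty_jPkg_midE_properTZ_two_two_lit p M x b w t z a c τ i i₀ hk κ hb hσ hc ha ha' hty
      · -- proper, inner class `2` (rows `d ≥ 2`)
        have hv : τ i = (true, 2) := Prod.ext hσ hc
        rcases h3 a₀ with h0 | h0 | h0 <;> subst h0
        · rw [hv, tgtReg_true_two_zero_two]
          exact nonempty_jPkg_midE_proper_zero_two_lit p M x b w t z a c τ i i₀ hk κ hb hσ hc ha ha' hty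
        · exact hK2 hv rfl rfl hty
        · rw [hv, tgtReg_true_two_two_two]
          exact nonempty_jPkg_midE_proper_two_two_lit p M x b w t z a c τ i i₀ hk κ hb hσ hc ha ha' hty
  · -- kind bit `false`: the level `k + 1` is of kind `midS` (`F‴`)
    by_cases ha'0 : a' = 0
    · subst ha'0
      rcases h3 (τ i).2 with hc | hc | hc
      · have hv : τ i = (false, 0) := Prod.ext hσ hc
        rw [hv, tgtReg_false]
        by_cases ha0 : a₀ = 0
        · subst ha0
          exact nonempty_jPkg_midS_zero_zero_zero' p M x b w t z a c τ i i₀ hk κ hb hσ hc ha ha'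
        · rw [blockAiotaSt'_of_ne 𝐋 κ (a := a₀) (b := 0) fun h => ha0 h.1]
          exact nonempty_jPkg_midS_zero_zero p M x b w t z a c τ i i₀ hk κ hb hσ hc a₀ ha ha0 ha'
      · have hv : τ i = (false, 1) := Prod.ext hσ hc
        rw [hv, tgtReg_false, blockAiotaSt'_of_ne 𝐋 κ (a := a₀) (b := 1) fun h => absurd h.2 (by decide)]
        by_cases ha0 : a₀ = 0
        · subst ha0
          exact nonempty_jPkg_midS_zero_one_zero p M x b w t z a c τ i i₀ hk κ hb hσ hc ha ha'
        · exact nonempty_jPkg_midS_one_zero p M x b w t z a c τ i i₀ hk κ hb hσ hc a₀ ha ha0 ha'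
      · have hv : τ i = (false, 2) := Prod.ext hσ hc
        rw [hv, tgtReg_false, blockAiotaSt'_of_ne 𝐋 κ (a := a₀) (b := 2) fun h => absurd h.2 (by decide)]
        exact nonempty_jPkg_midS_two_zero p M x b w t z a c τ i i₀ hk κ hb hσ hc a₀ ha ha'
    · by_cases hwt : w i.succ = t i.castSucc
      · exact hR' hσ ha'0 hwt
      rcases h3 (τ i).2 with hc | hc | hc
      · have hv : τ i = (false, 0) := Prod.ext hσ hc
        rw [hv, tgtReg_false]
        exact nonempty_jPkg_midS_zero_open' p M x b w t z a c τ i i₀ hk κ hb hσ hc a₀ ha ha' ha'0 hwt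
      · have hv : τ i = (false, 1) := Prod.ext hσ hc
        rw [hv, tgtReg_false, blockAiotaSt'_of_ne 𝐋 κ (a := a₀) (b := 1) fun h => absurd h.2 (by decide)]
        exact nonempty_jPkg_midS_one_open p M x b w t z a c τ i i₀ hk κ hb hσ hc a₀ ha ha' ha'0 hwt
      · have hv : τ i = (false, 2) := Prod.ext hσ hc
        rw [hv, tgtReg_false, blockAiotaSt'_of_ne 𝐋 κ (a := a₀) (b := 2) fun h => absurd h.2 (by decide)]
        exact nonempty_jPkg_midS_two_open p M x b w t z a c τ i i₀ hk κ hb hσ hc a₀ ha ha' ha'0 hwt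

/-! ### B. The first junction `k = 0` -/

/-- **`pkg` at the FIRST junction with regular class pair `(a₀, a′)`**: the same dispatch behind the start letter
`P^{S,a₀}(u_0, w_0)` ((6.5)–(6.10)), onto the first-junction cells of the packet; slots `hR'` (`F‴` on the corner
`w_1 = t_0`, `a′ ≠ 0`), `hR` (`F″` cut-through with `w_1 ∼ t_0`), `hK2` (row `(1, ≥2 | d ≥ 2)`) as in
`nonempty_jPkg_mid_reg`.
[cite: FitznerVanDerHofstad2017, §6.1 (6.4)–(6.10) "Case a = 0 / a = 1 / a ≥ 2", "Case b = 0 / b = 1 / b ≥ 2" (arXiv:1506.07977v2 pp. 58–59); §5.1 (5.4) (p. 48); App. B Table "B^{(2),ι,a,b}" (p. 76)] -/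
theorem nonempty_jPkg_first_reg (κ : Fin d × Bool)
    (hb : (b (0 : Fin (M + 1)).castSucc).2 = (b (0 : Fin (M + 1)).castSucc).1 + stepVec κ) (a₀ a' : Fin 3)
    (ha : a (0 : Fin (M + 1)).castSucc = Sum.inl a₀) (ha' : a (0 : Fin (M + 1)).succ = Sum.inl a')
    (hR' : (τ 0).1 = false → a' ≠ 0 → w (0 : Fin (M + 1)).succ = t (0 : Fin (M + 1)).castSucc →
      Nonempty (JPkg p (jctx M x b w t z a τ (0 : Fin (M + 1)).castSucc) (JFacts M x b w t z a c τ)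
        (blockPS 𝐋 a₀ (b (0 : Fin (M + 1)).castSucc).1 (w (0 : Fin (M + 1)).castSucc) *
          tgtReg 𝐋 κ a₀ a' (b (0 : Fin (M + 1)).castSucc).1 (w (0 : Fin (M + 1)).castSucc)
            (t (0 : Fin (M + 1)).castSucc) (z (0 : Fin (M + 1)).castSucc) (w (0 : Fin (M + 1)).succ)
            (b (0 : Fin (M + 1)).succ).1 (τ 0))))
    (hR : τ 0 = (true, 0) → a' = 2 → t (0 : Fin (M + 1)).castSucc ≠ (b (0 : Fin (M + 1)).succ).1 →
      z (0 : Fin (M + 1)).castSucc = t (0 : Fin (M + 1)).castSucc →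
      (zdGraph d).Adj (w (0 : Fin (M + 1)).succ) (t (0 : Fin (M + 1)).castSucc) →
      Nonempty (JPkg p (jctx M x b w t z a τ (0 : Fin (M + 1)).castSucc) (JFacts M x b w t z a c τ)
        (blockPS 𝐋 a₀ (b (0 : Fin (M + 1)).castSucc).1 (w (0 : Fin (M + 1)).castSucc) *
          tgtReg 𝐋 κ a₀ a' (b (0 : Fin (M + 1)).castSucc).1 (w (0 : Fin (M + 1)).castSucc)
            (t (0 : Fin (M + 1)).castSucc) (z (0 : Fin (M + 1)).castSucc) (w (0 : Fin (M + 1)).succ)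
            (b (0 : Fin (M + 1)).succ).1 (τ 0))))
    (hK2 : τ 0 = (true, 2) → a₀ = 1 → a' = 2 → t (0 : Fin (M + 1)).castSucc ≠ (b (0 : Fin (M + 1)).succ).1 →
      Nonempty (JPkg p (jctx M x b w t z a τ (0 : Fin (M + 1)).castSucc) (JFacts M x b w t z a c τ)
        (blockPS 𝐋 a₀ (b (0 : Fin (M + 1)).castSucc).1 (w (0 : Fin (M + 1)).castSucc) *
          tgtReg 𝐋 κ a₀ a' (b (0 : Fin (M + 1)).castSucc).1 (w (0 : Fin (M + 1)).castSucc)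
            (t (0 : Fin (M + 1)).castSucc) (z (0 : Fin (M + 1)).castSucc) (w (0 : Fin (M + 1)).succ)
            (b (0 : Fin (M + 1)).succ).1 (τ 0)))) :
    Nonempty (JPkg p (jctx M x b w t z a τ (0 : Fin (M + 1)).castSucc) (JFacts M x b w t z a c τ)
      (blockPS 𝐋 a₀ (b (0 : Fin (M + 1)).castSucc).1 (w (0 : Fin (M + 1)).castSucc) *
        tgtReg 𝐋 κ a₀ a' (b (0 : Fin (M + 1)).castSucc).1 (w (0 : Fin (M + 1)).castSucc)
          (t (0 : Fin (M + 1)).castSucc) (z (0 : Fin (M + 1)).castSucc) (w (0 : Fin (M + 1)).succ)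
          (b (0 : Fin (M + 1)).succ).1 (τ 0))) := by
  have h3 : ∀ e : Fin 3, e = 0 ∨ e = 1 ∨ e = 2 := by decide
  rcases Bool.eq_false_or_eq_true (τ 0).1 with hσ | hσ
  · -- kind bit `true`: level `1` is of kind `midE`
    by_cases hty : t (0 : Fin (M + 1)).castSucc = (b (0 : Fin (M + 1)).succ).1
    · -- `F′`
      rcases h3 (τ 0).2 with hc | hc | hc
      · have hv : τ 0 = (true, 0) := Prod.ext hσ hc
        rw [hv, tgtReg_true_zero]
        exact nonempty_jPkg_firstF1_term₂' p M x b w t z a c τ κ hb hσ a₀ a' ha ha' hty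
      all_goals
        by_cases hzt : z (0 : Fin (M + 1)).castSucc = t (0 : Fin (M + 1)).castSucc
        · exact nonempty_jPkg_of_innerClass_ne_zero_eq p c _ 0 (by rw [hc]; decide) hzt.symm _
        · exact nonempty_jPkg_of_midE_t_eq_z_ne p M x b w t z a c τ _ 0 hσ ha' hty hzt _
    · -- `F″`
      by_cases ha'2 : a' = 2
      swap
      · exact nonempty_jPkg_of_sharp p c _ 0 hσ ha' ha'2 hty _
      subst ha'2
      rcases h3 (τ 0).2 with hc | hc | hc
      · -- cut-through
        by_cases hzt : z (0 : Fin (M + 1)).castSucc = t (0 : Fin (M + 1)).castSucc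
        swap
        · exact nonempty_jPkg_of_innerClass_zero_ne p c _ 0 hc (Ne.symm hzt) _
        by_cases hadj : (zdGraph d).Adj (w (0 : Fin (M + 1)).succ) (t (0 : Fin (M + 1)).castSucc)
        · exact hR (Prod.ext hσ hc) rfl hty hzt hadj
        · have hv : τ 0 = (true, 0) := Prod.ext hσ hc
          rw [hv, tgtReg_true_zero]
          exact nonempty_jPkg_firstE_cut_term₂' p M x b w t z a c τ κ hb hσ a₀ ha ha' hty hzt hadj
      · -- proper, inner class `1`
        have hv : τ 0 = (true, 1) := Prod.ext hσ hc
        rcases h3 a₀ with h0 | h0 | h0 <;> subst h0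
        · rw [hv, tgtReg_true_one_zero_two]
          exact nonempty_jPkg_firstE_properTZ_zero_two_lit p M x b w t z a c τ κ hb hσ hc ha ha' hty
        · rw [hv, tgtReg_true_one_one_two]
          exact nonempty_jPkg_firstE_properTZ_one_two_lit p M x b w t z a c τ κ hb hσ hc ha ha' hty
        · rw [hv, tgtReg_true_one_two_two]
          exact nonempty_jPkg_firstE_properTZ_two_two_lit p M x b w t z a c τ κ hb hσ hc ha ha' hty
      · -- proper, inner class `2`
        have hv : τ 0 = (true, 2) := Prod.ext hσ hc
        rcases h3 a₀ with h0 | h0 | h0 <;> subst h0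
        · rw [hv, tgtReg_true_two_zero_two]
          exact nonempty_jPkg_firstE_proper_zero_two_lit p M x b w t z a c τ κ hb hσ hc ha ha' hty
        · exact hK2 hv rfl rfl hty
        · rw [hv, tgtReg_true_two_two_two]
          exact nonempty_jPkg_firstE_proper_two_two_lit p M x b w t z a c τ κ hb hσ hc ha ha' hty
  · -- kind bit `false`: level `1` is of kind `midS` (`F‴`)
    by_cases ha'0 : a' = 0
    · subst ha'0
      rcases h3 (τ 0).2 with hc | hc | hc
      · have hv : τ 0 = (false, 0) := Prod.ext hσ hc
        rw [hv, tgtReg_false]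
        by_cases ha0 : a₀ = 0
        · subst ha0
          exact nonempty_jPkg_firstS_zero_zero_zero' p M x b w t z a c τ κ hb hσ hc ha ha'
        · rw [blockAiotaSt'_of_ne 𝐋 κ (a := a₀) (b := 0) fun h => ha0 h.1]
          exact nonempty_jPkg_firstS_ne_zero_zero p M x b w t z a c τ κ hb hσ hc a₀ ha ha0 ha'
      · have hv : τ 0 = (false, 1) := Prod.ext hσ hc
        rw [hv, tgtReg_false, blockAiotaSt'_of_ne 𝐋 κ (a := a₀) (b := 1) fun h => absurd h.2 (by decide)]
        by_cases ha0 : a₀ = 0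
        · subst ha0
          exact nonempty_jPkg_firstS_zero_one_zero p M x b w t z a c τ κ hb hσ hc ha ha'
        · exact nonempty_jPkg_firstS_ne_one_zero p M x b w t z a c τ κ hb hσ hc a₀ ha ha0 ha'
      · have hv : τ 0 = (false, 2) := Prod.ext hσ hc
        rw [hv, tgtReg_false, blockAiotaSt'_of_ne 𝐋 κ (a := a₀) (b := 2) fun h => absurd h.2 (by decide)]
        exact nonempty_jPkg_firstS_two_zero p M x b w t z a c τ κ hb hσ hc a₀ ha ha'
    · by_cases hwt : w (0 : Fin (M + 1)).succ = t (0 : Fin (M + 1)).castSucc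
      · exact hR' hσ ha'0 hwt
      have hv : τ 0 = (false, (τ 0).2) := Prod.ext hσ rfl
      rw [hv, tgtReg_false]
      exact nonempty_jPkg_firstS_open' p M x b w t z a c τ κ hb hσ (τ 0).2 rfl a₀ ha ha' ha'0 hwt

end Packages

end Literature.Probability.FitznerVanDerHofstad2017

end
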